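import Literature.MathematicalPhysics.QuantumLattice.HubbardChainEnergyDensity
import Mathlib.Combinatorics.SimpleGraph.Hasse
import HarnessLib

/-!
# Open segments bound the Hubbard ring from above: exact subadditivity under cuts without
# crossing bonds (soundness of the segment-product upper-bound certificates for the Hubbard chain)

Topic `MathematicalPhysics/QuantumLattice` (family `hubbard`); continues
`HubbardModelThermodynamicLimitProofs.lean`, whose cut theorem
`ThermodynamicLimit.groundEnergyAt_le_add_of_cut` (graded tensor product `ψ₁ ⊗ ψ₂` of sector trial
vectors; hopping ACROSS the cut has zero expectation in a product of fixed-particle-number factors;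
bonds present in only one of the two adjacency patterns cost `≤ 2|t|` each) was used there with the
`8|t|` defect of cutting a RING into two rings. Here the blocks are OPEN SEGMENTS
(`SimpleGraph.pathGraph a` on `Fin a`, Mathlib's path graph; the Hubbard Hamiltonian on it is the
tree's `hamiltonian (SimpleGraph.pathGraph a) t U`, i.e.
`-t Σ_{j+1=j', σ} (c†_{jσ} c_{j'σ} + h.c.) + U Σ_j n_{j↑} n_{j↓}`), and the defect is ZERO:

* `groundEnergyAt_pathGraph_add_le` — **cutting an open chain is free**:
  `E_{path(a+b)}(N₁ + N₂) ≤ E_{path a}(N₁) + E_{path b}(N₂)` (`N₁ ≤ 2a`, `N₂ ≤ 2b`): inside each block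
  the adjacency of the long path IS the adjacency of the short path.
* `groundEnergyAt_pathGraph_mul_le` — by induction, `E_{path(a·m)}(N₀·m) ≤ m · E_{path a}(N₀)`.
* `groundEnergyAt_ring_le_pathGraph_add` — **closing the ring is free as well**:
  `E_{ring(L₁+L₂)}(N₁ + N₂) ≤ E_{path L₁}(N₁) + E_{path L₂}(N₂)` for `L₁, L₂ ≥ 1`, `L₁ + L₂ ≥ 3`
  (`ring L = fermionTorusGraph 1 L`): inside the block `{0,…,L₁-1}` of the ring `ℤ/(L₁+L₂)ℤ` the ring
  adjacency is the path adjacency (the wrap-around bond joins the two DIFFERENT blocks), and likewise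
  in the upper block.
* `groundEnergyAt_ring_le_mul_segment` — hence **`E_{ring(a·m)}(N₀·m) ≤ m · E_{path a}(N₀)`** for
  `m ≥ 2`, `a·m ≥ 3`, `N₀ ≤ 2a`, all real `t, U`; with the variational principle
  (`groundEnergy_le_re_expect`) `E_{ring(a·m)}(N₀·m) ≤ m · Re⟨ψ, H_{path a} ψ⟩` for every unit
  `N₀`-particle vector `ψ` of the segment (`groundEnergyAt_ring_le_mul_re_expect_segment`).
* The ring-family form of certificate bundles (half filling, `N₀ = a`):
  `∀ L, a ∣ L → 2a ≤ L → E_{ring L}(L) ≤ q · L` whenever `Re⟨ψ, H_{path a} ψ⟩ ≤ q · a`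
  (`hubbardRing_groundEnergyAt_le_of_segment_state`), and the thermodynamic limit
  `hubbardChainEnergyDensity t U ≤ E_{path a}(a) / a ≤ Re⟨ψ, H_{path a} ψ⟩ / a` (`U ≥ 0`;
  `hubbardChainEnergyDensity_le_segment`, `hubbardChainEnergyDensity_le_re_expect_segment`).

This is the textbook variational principle with a product of segment states (for fermions: the
graded tensor product of fixed-particle-number segment vectors, so that every inter-segment hopping
term has zero expectation), the standard first half of the existence proof of the thermodynamic limit
(D. Ruelle, *Statistical Mechanics* (1969) §2.2; for lattice fermions e.g. the tree's
`groundEnergyAt_le_add_of_cut`). How a segment vector was found (exact diagonalisation, DMRG rounded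
to integers, …) is irrelevant to the bound. No definitions besides the decidability instance for
Mathlib's path graph; no named facts.
-/

noncomputable section

open Matrix Finset Filter Topology
open scoped ComplexOrder BigOperators

namespace Literature.MathematicalPhysics.QuantumLattice

open HubbardWave0 Literature.Probability.LatticeModels ThermodynamicLimit

/-- Adjacency of Mathlib's path graph `pathGraph n` on `Fin n` (`u ∼ v ↔ u + 1 = v ∨ v + 1 = u`) is
decidable; needed to form `hamiltonian (SimpleGraph.pathGraph n) t U`. [folklore] -/
instance instDecidableRelPathGraphAdj (n : ℕ) : DecidableRel (SimpleGraph.pathGraph n).Adj :=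
  fun _ _ => decidable_of_iff _ SimpleGraph.pathGraph_adj.symm

namespace ThermodynamicLimit

/-! ### Cutting an open chain is free -/

/-- **Cutting an open Hubbard chain costs nothing**: for the path graphs on `a + b = a ⊔ b` sites,
`E_{path(a+b)}(N₁ + N₂) ≤ E_{path a}(N₁) + E_{path b}(N₂)` for all real `t, U` and sectors
`N₁ ≤ 2a`, `N₂ ≤ 2b` (the adjacency of the long chain restricted to each block is that of the block;
the one bond across the cut has zero expectation in the product trial state). Ruelle (1969) §2.2.
[folklore] -/
theorem groundEnergyAt_pathGraph_add_le (a b : ℕ) (t U : ℝ) {N₁ N₂ : ℕ} (hN₁ : N₁ ≤ 2 * a)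
    (hN₂ : N₂ ≤ 2 * b) :
    groundEnergyAt (SimpleGraph.pathGraph (a + b)) t U (N₁ + N₂) ≤
      groundEnergyAt (SimpleGraph.pathGraph a) t U N₁ + groundEnergyAt (SimpleGraph.pathGraph b) t U N₂ := by
  set e₁ : Fin a → Fin (a + b) := Fin.castAdd b with he₁def
  set e₂ : Fin b → Fin (a + b) := Fin.natAdd a with he₂def
  have hv₁ : ∀ x, (e₁ x : ℕ) = x := fun x => rfl
  have hv₂ : ∀ y, (e₂ y : ℕ) = a + y := fun y => rfl
  have he₁ : StrictMono e₁ := fun x x' h => by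
    rw [Fin.lt_def] at h ⊢
    rw [hv₁, hv₁]
    exact h
  have he₂ : StrictMono e₂ := fun y y' h => by
    rw [Fin.lt_def] at h ⊢
    rw [hv₂, hv₂]
    omega
  have h12 : ∀ x y, e₁ x < e₂ y := fun x y => by
    rw [Fin.lt_def, hv₁, hv₂]
    have := x.isLt
    omega
  have hcov : ∀ z, (∃ x, e₁ x = z) ∨ ∃ y, e₂ y = z := by
    intro z
    obtain ⟨x | y, h⟩ := finSumFinEquiv.surjective z
    · exact Or.inl ⟨x, by simpa using h⟩
    · exact Or.inr ⟨y, by simpa using h⟩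
  have hk₁ : #{p : Fin a × Fin a | ¬ ((SimpleGraph.pathGraph (a + b)).Adj (e₁ p.1) (e₁ p.2) ↔
      (SimpleGraph.pathGraph a).Adj p.1 p.2)} ≤ 0 := by
    rw [Nat.le_zero, Finset.card_eq_zero, Finset.filter_eq_empty_iff]
    intro p _ h
    apply h
    rw [SimpleGraph.pathGraph_adj, SimpleGraph.pathGraph_adj, hv₁, hv₁]
  have hk₂ : #{p : Fin b × Fin b | ¬ ((SimpleGraph.pathGraph (a + b)).Adj (e₂ p.1) (e₂ p.2) ↔
      (SimpleGraph.pathGraph b).Adj p.1 p.2)} ≤ 0 := by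
    rw [Nat.le_zero, Finset.card_eq_zero, Finset.filter_eq_empty_iff]
    intro p _ h
    apply h
    rw [SimpleGraph.pathGraph_adj, SimpleGraph.pathGraph_adj, hv₂, hv₂]
    omega
  have h := groundEnergyAt_le_add_of_cut (SimpleGraph.pathGraph a) (SimpleGraph.pathGraph b)
    (SimpleGraph.pathGraph (a + b)) he₁ he₂ h12 hcov hk₁ hk₂ t U (N₁ := N₁) (N₂ := N₂)
    (by simpa using hN₁) (by simpa using hN₂)
  have h0 : (2 : ℝ) * |t| * ((0 : ℕ) + (0 : ℕ)) = 0 := by push_cast; ring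
  linarith

/-- **`m` segments**: `E_{path(a·m)}(N₀·m) ≤ m · E_{path a}(N₀)` for `m ≥ 1`, `N₀ ≤ 2a` (cut the open
chain of `a·m` sites into `m` open segments of `a` sites, `groundEnergyAt_pathGraph_add_le`).
Ruelle (1969) §2.2. [folklore] -/
theorem groundEnergyAt_pathGraph_mul_le (a : ℕ) (t U : ℝ) {N₀ : ℕ} (hN₀ : N₀ ≤ 2 * a) :
    ∀ m : ℕ, 1 ≤ m →
      groundEnergyAt (SimpleGraph.pathGraph (a * m)) t U (N₀ * m) ≤
        m * groundEnergyAt (SimpleGraph.pathGraph a) t U N₀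
  | 0, h => absurd h (by omega)
  | 1, _ => by
    rw [Nat.mul_one, Nat.mul_one, Nat.cast_one, one_mul]
  | m + 2, _ => by
    have ih := groundEnergyAt_pathGraph_mul_le a t U hN₀ (m + 1) (by omega)
    have hcut := groundEnergyAt_pathGraph_add_le (a * (m + 1)) a t U (N₁ := N₀ * (m + 1)) (N₂ := N₀)
      (by nlinarith) hN₀
    show groundEnergyAt (SimpleGraph.pathGraph (a * (m + 1) + a)) t U (N₀ * (m + 1) + N₀) ≤ _
    push_cast at ih ⊢
    linarith

/-! ### Closing the ring is free -/

/-- Arithmetic of the lower block: inside `{0, …, L₁ - 1} ⊆ ℤ/(L₁+L₂)ℤ` (`L₂ ≥ 1`) the ring adjacency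
is the path adjacency. [folklore] -/
theorem ring_adj_low_iff {L₁ L₂ x y : ℕ} (hx : x < L₁) (hy : y < L₁) (hL₂ : 1 ≤ L₂) :
    (x ≠ y ∧ ((x + 1) % (L₁ + L₂) = y ∨ (y + 1) % (L₁ + L₂) = x)) ↔ (x + 1 = y ∨ y + 1 = x) := by
  rw [Nat.mod_eq_of_lt (by omega : x + 1 < L₁ + L₂), Nat.mod_eq_of_lt (by omega : y + 1 < L₁ + L₂)]
  omega

/-- Arithmetic of the upper block: inside `{L₁, …, L₁ + L₂ - 1} ⊆ ℤ/(L₁+L₂)ℤ` (`L₁ ≥ 1`) the ring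
adjacency is the (translated) path adjacency. [folklore] -/
theorem ring_adj_high_iff {L₁ L₂ x y : ℕ} (hx : x < L₂) (hy : y < L₂) (hL₁ : 1 ≤ L₁) :
    (L₁ + x ≠ L₁ + y ∧ ((L₁ + x + 1) % (L₁ + L₂) = L₁ + y ∨ (L₁ + y + 1) % (L₁ + L₂) = L₁ + x)) ↔
      (x + 1 = y ∨ y + 1 = x) := by
  rcases Nat.lt_or_ge (x + 1) L₂ with h1 | h1
  · rw [Nat.mod_eq_of_lt (by omega : L₁ + x + 1 < L₁ + L₂)]
    rcases Nat.lt_or_ge (y + 1) L₂ with h2 | h2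
    · rw [Nat.mod_eq_of_lt (by omega : L₁ + y + 1 < L₁ + L₂)]
      omega
    · rw [show L₁ + y + 1 = L₁ + L₂ by omega, Nat.mod_self]
      omega
  · rw [show L₁ + x + 1 = L₁ + L₂ by omega, Nat.mod_self]
    rcases Nat.lt_or_ge (y + 1) L₂ with h2 | h2
    · rw [Nat.mod_eq_of_lt (by omega : L₁ + y + 1 < L₁ + L₂)]
      omega
    · rw [show L₁ + y + 1 = L₁ + L₂ by omega, Nat.mod_self]
      omega

/-- **Closing an open chain into a ring costs nothing**: for `L₁, L₂ ≥ 1` with `L₁ + L₂ ≥ 3`,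
`E_{ring(L₁+L₂)}(N₁ + N₂) ≤ E_{path L₁}(N₁) + E_{path L₂}(N₂)` (`ring L = fermionTorusGraph 1 L`, the
Hubbard ring `ℤ/Lℤ`; all real `t, U`; `N_i ≤ 2 L_i`). Both ring bonds joining the two blocks — the cut
bond AND the wrap-around bond — have zero expectation in the product of fixed-particle-number block
states, and inside each block the ring adjacency is the path adjacency. Ruelle (1969) §2.2. [folklore] -/
theorem groundEnergyAt_ring_le_pathGraph_add (L₁ L₂ : ℕ) (hL₁ : 1 ≤ L₁) (hL₂ : 1 ≤ L₂)
    (t U : ℝ) {N₁ N₂ : ℕ} (hN₁ : N₁ ≤ 2 * L₁) (hN₂ : N₂ ≤ 2 * L₂) :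
    groundEnergyAt (fermionTorusGraph 1 (L₁ + L₂)) t U (N₁ + N₂) ≤
      groundEnergyAt (SimpleGraph.pathGraph L₁) t U N₁ +
        groundEnergyAt (SimpleGraph.pathGraph L₂) t U N₂ := by
  set e₁ : Fin L₁ → FermionTorus 1 (L₁ + L₂) :=
    fun x => toLex fun _ : Fin 1 => Fin.castAdd L₂ x with he₁def
  set e₂ : Fin L₂ → FermionTorus 1 (L₁ + L₂) :=
    fun y => toLex fun _ : Fin 1 => Fin.natAdd L₁ y with he₂def
  have hv₁ : ∀ x, (ofLex (e₁ x) 0 : ℕ) = x := fun x => by simp [he₁def]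
  have hv₂ : ∀ y, (ofLex (e₂ y) 0 : ℕ) = L₁ + y := fun y => by simp [he₂def]
  -- the order on the ring sites is the order of the coordinate values
  have fermionTorus_one_lt_iff : ∀ {M : ℕ} (u v : FermionTorus 1 M),
      u < v ↔ (ofLex u 0 : ℕ) < (ofLex v 0 : ℕ) :=
    fun u v => Pi.Lex.lt_iff_of_unique.trans Fin.lt_def
  have he₁ : StrictMono e₁ := by
    intro x x' h
    rw [fermionTorus_one_lt_iff, hv₁, hv₁]
    exact Fin.lt_def.1 h
  have he₂ : StrictMono e₂ := by
    intro y y' h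
    rw [fermionTorus_one_lt_iff, hv₂, hv₂]
    have := Fin.lt_def.1 h
    omega
  have h12 : ∀ x y, e₁ x < e₂ y := by
    intro x y
    rw [fermionTorus_one_lt_iff, hv₁, hv₂]
    have := x.isLt
    omega
  have hcov : ∀ z, (∃ x, e₁ x = z) ∨ ∃ y, e₂ y = z := by
    intro z
    obtain ⟨x | y, h⟩ := finSumFinEquiv.surjective (ofLex z 0)
    · refine Or.inl ⟨x, fermionTorus_one_ext ?_⟩
      rw [he₁def]
      simpa using h
    · refine Or.inr ⟨y, fermionTorus_one_ext ?_⟩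
      rw [he₂def]
      simpa using h
  have hk₁ : #{p : Fin L₁ × Fin L₁ | ¬ ((fermionTorusGraph 1 (L₁ + L₂)).Adj (e₁ p.1) (e₁ p.2) ↔
      (SimpleGraph.pathGraph L₁).Adj p.1 p.2)} ≤ 0 := by
    rw [Nat.le_zero, Finset.card_eq_zero, Finset.filter_eq_empty_iff]
    intro p _ h
    apply h
    rw [fermionTorusGraph_one_adj_iff, SimpleGraph.pathGraph_adj, hv₁, hv₁]
    exact ring_adj_low_iff p.1.isLt p.2.isLt hL₂
  have hk₂ : #{p : Fin L₂ × Fin L₂ | ¬ ((fermionTorusGraph 1 (L₁ + L₂)).Adj (e₂ p.1) (e₂ p.2) ↔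
      (SimpleGraph.pathGraph L₂).Adj p.1 p.2)} ≤ 0 := by
    rw [Nat.le_zero, Finset.card_eq_zero, Finset.filter_eq_empty_iff]
    intro p _ h
    apply h
    rw [fermionTorusGraph_one_adj_iff, SimpleGraph.pathGraph_adj, hv₂, hv₂]
    exact ring_adj_high_iff p.1.isLt p.2.isLt hL₁
  have h := groundEnergyAt_le_add_of_cut (SimpleGraph.pathGraph L₁) (SimpleGraph.pathGraph L₂)
    (fermionTorusGraph 1 (L₁ + L₂)) he₁ he₂ h12 hcov hk₁ hk₂ t U (N₁ := N₁) (N₂ := N₂)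
    (by simpa using hN₁) (by simpa using hN₂)
  have h0 : (2 : ℝ) * |t| * ((0 : ℕ) + (0 : ℕ)) = 0 := by push_cast; ring
  linarith

/-! ### The segment bound for the ring -/

/-- **The open segment bounds the ring from above**: for `m ≥ 2` segments of `a ≥ 1` sites with
`a·m ≥ 3`, all real `t, U` and `N₀ ≤ 2a`,
`E_{ring(a·m)}(N₀·m) ≤ m · E_{path a}(N₀)` — the Hubbard ring `ℤ/(am)ℤ` with `N₀ m` electrons against
the open Hubbard chain of `a` sites with `N₀` electrons. Close the open chain of `a(m-1) + a` sites
into the ring (`groundEnergyAt_ring_le_pathGraph_add`) and cut it into segments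
(`groundEnergyAt_pathGraph_mul_le`). Ruelle (1969) §2.2. [folklore] -/
theorem groundEnergyAt_ring_le_mul_segment (a m : ℕ) (ha : 1 ≤ a) (hm : 2 ≤ m) (t U : ℝ)
    {N₀ : ℕ} (hN₀ : N₀ ≤ 2 * a) :
    groundEnergyAt (fermionTorusGraph 1 (a * m)) t U (N₀ * m) ≤
      m * groundEnergyAt (SimpleGraph.pathGraph a) t U N₀ := by
  obtain ⟨m', rfl⟩ : ∃ m', m = m' + 1 := ⟨m - 1, by omega⟩
  have hm' : 1 ≤ m' := by omega
  have hclose := groundEnergyAt_ring_le_pathGraph_add (a * m') a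
    (le_trans hm' (by nlinarith)) ha t U (N₁ := N₀ * m') (N₂ := N₀) (by nlinarith) hN₀
  have hcut := groundEnergyAt_pathGraph_mul_le a t U hN₀ m' hm'
  show groundEnergyAt (fermionTorusGraph 1 (a * m' + a)) t U (N₀ * m' + N₀) ≤ _
  push_cast
  linarith

/-- **Variational form**: every unit `N₀`-particle vector `ψ` of the open segment of `a` sites gives
`E_{ring(a·m)}(N₀·m) ≤ m · Re⟨ψ, H_{path a} ψ⟩` (`m ≥ 2`, `a ≥ 1`, `N₀ ≤ 2a`; `H_{path a} =
hamiltonian (SimpleGraph.pathGraph a) t U`). This is the segment-product trial state: the graded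
tensor product of `m` copies of `ψ` placed on consecutive segments of the ring. Ruelle (1969) §2.2.
[folklore] -/
theorem groundEnergyAt_ring_le_mul_re_expect_segment (a m : ℕ) (ha : 1 ≤ a) (hm : 2 ≤ m) (t U : ℝ)
    {N₀ : ℕ} (hN₀ : N₀ ≤ 2 * a) (ψ : Fock (Orb (Fin a))) (hψN : IsNParticle N₀ ψ)
    (hψ1 : star ψ ⬝ᵥ ψ = 1) :
    groundEnergyAt (fermionTorusGraph 1 (a * m)) t U (N₀ * m) ≤
      m * (star ψ ⬝ᵥ (hamiltonian (SimpleGraph.pathGraph a) t U *ᵥ ψ)).re := by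
  have h1 := groundEnergyAt_ring_le_mul_segment a m ha hm t U hN₀
  have h2 : groundEnergyAt (SimpleGraph.pathGraph a) t U N₀ ≤
      (star ψ ⬝ᵥ (hamiltonian (SimpleGraph.pathGraph a) t U *ᵥ ψ)).re :=
    groundEnergy_le_re_expect _ hψN hψ1
  have hm0 : (0 : ℝ) ≤ m := Nat.cast_nonneg m
  nlinarith

/-! ### The ring-family form and the thermodynamic limit (half filling) -/

/-- **Ring-family form (half filling)**: a unit `a`-particle vector `ψ` of the open segment of
`a ≥ 2` sites with `Re⟨ψ, H_{path a} ψ⟩ ≤ q · a` certifies `E_{ring L}(L) ≤ q · L` for every ring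
`ℤ/Lℤ` with `a ∣ L` and `2a ≤ L` (`E_{ring L}(L) = groundEnergyAt (fermionTorusGraph 1 L) t U L`, the
half-filled sector). This is the shape of the ring-family upper-bound rows
`∀ L, a ∣ L → 2a ≤ L → E_L(L) ≤ q·L` of certificate bundles (exact-diagonalisation or integer
matrix-product segment vectors). Ruelle (1969) §2.2. [folklore] -/
theorem hubbardRing_groundEnergyAt_le_of_segment_state (t U : ℝ) {a : ℕ} (ha : 2 ≤ a)
    (ψ : Fock (Orb (Fin a))) (hψN : IsNParticle a ψ) (hψ1 : star ψ ⬝ᵥ ψ = 1) {q : ℝ}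
    (hq : (star ψ ⬝ᵥ (hamiltonian (SimpleGraph.pathGraph a) t U *ᵥ ψ)).re ≤ q * a)
    (L : ℕ) (hdvd : a ∣ L) (hL : 2 * a ≤ L) :
    groundEnergyAt (fermionTorusGraph 1 L) t U L ≤ q * L := by
  obtain ⟨c, rfl⟩ := hdvd
  have hc2 : 2 ≤ c := by
    have h1 : a * 2 ≤ a * c := by omega
    exact Nat.le_of_mul_le_mul_left h1 (by omega)
  have h := groundEnergyAt_ring_le_mul_re_expect_segment a c (by omega) hc2 t U (N₀ := a) (by omega)
    ψ hψN hψ1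
  have hcR : (0 : ℝ) ≤ (c : ℝ) := Nat.cast_nonneg c
  calc groundEnergyAt (fermionTorusGraph 1 (a * c)) t U (a * c)
      ≤ c * (star ψ ⬝ᵥ (hamiltonian (SimpleGraph.pathGraph a) t U *ᵥ ψ)).re := h
    _ ≤ c * (q * a) := mul_le_mul_of_nonneg_left hq hcR
    _ = q * ((a * c : ℕ) : ℝ) := by push_cast; ring

/-- **Thermodynamic limit, segment ground energies**: `e(t, U) ≤ E_{path a}(a) / a` for every
`a ≥ 1` (`U ≥ 0`, where `e = hubbardChainEnergyDensity t U = lim_L E_{ring L}(L)/L` exists): apply the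
segment bound along the rings `L = a(m+2)` and pass to the limit. Ruelle (1969) §2.2. [folklore] -/
theorem hubbardChainEnergyDensity_le_segment (t : ℝ) {U : ℝ} (hU : 0 ≤ U) {a : ℕ} (ha : 1 ≤ a) :
    hubbardChainEnergyDensity t U ≤ groundEnergyAt (SimpleGraph.pathGraph a) t U a / a := by
  set Ls : ℕ → ℕ := fun m => a * (m + 2) with hLs
  have hLs_tendsto : Tendsto Ls atTop atTop := by
    refine tendsto_atTop_mono (fun m => ?_) tendsto_id
    show m ≤ a * (m + 2)
    nlinarith
  have hlim := (tendsto_hubbardChainEnergyDensity t hU).comp hLs_tendsto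
  refine le_of_tendsto' hlim fun m => ?_
  have haR : (0 : ℝ) < a := by exact_mod_cast ha
  have hLpos : (0 : ℝ) < ((a * (m + 2) : ℕ) : ℝ) := by positivity
  have h := groundEnergyAt_ring_le_mul_segment a (m + 2) ha (by omega) t U (N₀ := a) (by omega)
  rw [Function.comp_apply, energyPerSite_fermionTorusGraph_one, div_le_div_iff₀ hLpos haR]
  calc groundEnergyAt (fermionTorusGraph 1 (a * (m + 2))) t U (a * (m + 2)) * a
      ≤ ((m + 2 : ℕ) : ℝ) * groundEnergyAt (SimpleGraph.pathGraph a) t U a * a :=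
        mul_le_mul_of_nonneg_right h haR.le
    _ = groundEnergyAt (SimpleGraph.pathGraph a) t U a * ((a * (m + 2) : ℕ) : ℝ) := by
        push_cast
        ring

/-- **Thermodynamic limit, segment trial states**: `e(t, U) ≤ Re⟨ψ, H_{path a} ψ⟩ / a` for every unit
`a`-particle vector `ψ` of the open segment of `a ≥ 1` sites (`U ≥ 0`). The thermodynamic-limit form of
the segment-product upper-bound certificates. Ruelle (1969) §2.2. [folklore] -/
theorem hubbardChainEnergyDensity_le_re_expect_segment (t : ℝ) {U : ℝ} (hU : 0 ≤ U) {a : ℕ}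
    (ha : 1 ≤ a) (ψ : Fock (Orb (Fin a))) (hψN : IsNParticle a ψ) (hψ1 : star ψ ⬝ᵥ ψ = 1) :
    hubbardChainEnergyDensity t U ≤
      (star ψ ⬝ᵥ (hamiltonian (SimpleGraph.pathGraph a) t U *ᵥ ψ)).re / a := by
  have h1 := hubbardChainEnergyDensity_le_segment t hU ha
  have h2 : groundEnergyAt (SimpleGraph.pathGraph a) t U a ≤
      (star ψ ⬝ᵥ (hamiltonian (SimpleGraph.pathGraph a) t U *ᵥ ψ)).re :=
    groundEnergy_le_re_expect _ hψN hψ1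
  have haR : (0 : ℝ) < a := by exact_mod_cast ha
  exact h1.trans (div_le_div_of_nonneg_right h2 haR.le)

end ThermodynamicLimit

end Literature.MathematicalPhysics.QuantumLattice

end
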